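import Summits.Schanuel.Schanuel.Theorems.RootDecomp1KLocalExponent06

/-!
# RootDecomp1KIntegrality — lens 1, generation 55, NODE 15 «ODD-PLACE INTEGRALITY (Gauss on the level polynomial)» (RULE K-R45 payable clause; K-R46) — part 1 (RootDecomp1KIntegrality01): §1 the level polynomial and Gauss at the odd places, §2 bounded height

(lens-1 g55 NODE 15 HOME kernel K = HOME/decomp-schanuel-lens-1/g55/Integrality.lean 64be435d…, 1006 l, 116 thm + 1 lemma + 10 def, imports tree …RootDecomp1KLocalExponent06 ONLY (no Literature import); Probe / Ctrl0 / Ctrl + NODE-g55.md + SHA256SUMS; CLAIM L2635, crit EX-ANTE PRICE L2637 (ONE THEOREM ×1 under K-R45's payable clause «an infinite class of FRONTIER pairs made unconditional, any input» iff CHECKLIST K-g55; anti-salami: the one credit covers the integrality lever at BOTH ends of the level polynomial; RULE K-R46 pre-announced), census LIVENESS-v5 (GaussAt column) L2636 / crit L2639, NODE L2640 / REQUEST L2641, census STAGING NOTE 5 L2643, critic VERDICT L2642: CLEARED — THEOREM ×1 under K-R45 payable clause (EX-ANTE PRICE L2637), CHECKLIST K-g55 met; RULE K-R46 FIXED (toolkit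 of record ∪ Gauss divisibility on levelPoly; amended FRONTIER; tabled conditional-only members at 2 = M17P, L17P); PORT GO (verbatim; docstrings/provenance only; the dedup deletions announced L2643). Port by census-1 gen 22 as `RootDecomp1KIntegrality01–04` (`--supports stmt-Schanuel-33364`; no census credit): 01 = §1 the level polynomial `levelPoly` over ℤ and GAUSS AT THE ODD PLACES — `DomZero`, `leadingCoeff_levelPoly`, **`den_dvd_of_level`** (den r ∣ lc(c₀)·2^(v₂ den r)), `den_le_of_level` + §2 bounded height: `finite_rat_of_abs_le_den_le`, `levels_finite_of_bounded`; 02 = §3 ENGINE `thinFibreAt_of_dom_farClause` / `thinFibreAt_of_dom_slopeCond` (node 14's engine with the root condition DELETED) + §4 the class **`GaussAt m₀ P`** (intrinsic: P ≠ 0 ∧ deg_Y c₀ > deg_Y c_j (1 ≤ j ≤ xdeg P) ∧ SlopeCond) and THE THEOREM **`thinFibreAt_of_gaussAt : GaussAt m₀ P → ThinFibreAt m₀ P`** (every m₀), `gaussAt_xPolyP_iff`, `gaussAt_mono` + §5 the frontier-certified member **`thinFibreAt_H17P_all : 1 ≤ m₀ → ThinFibreAt m₀ H17P` HYPOTHESIS-FREE**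 (node 12's HeightComparison binder removed; `gaussAt_H17P`, `not_localAt_H17P`); 03 = §6 the members `RC2` = x²(Y−1)² + x(Y³−2) + Y⁵ (rational DOUBLE centre) and `GC2` = x²(Y²−17) + x(Y³+Y+1) + (Y⁴+Y³−2) (irrational simple ℚ₂-centres) at m₀ = 2 hyp-free, with their costume tests; 04 = §7 the infinite family `H17D D` + §8 position of the class (`not_gaussAt_L13`, `not_gaussAt_M17P`, …) + §9 bookkeeping ×0 (`GaussOffAt`). PORT EDITS: TWO dedup.landed twins DELETED for the tree decls (head dry-run): K's `finite_rat_of_abs_le_den_le` (≡ `RootDecomp1KLevelFinite.finite_rat_of_abs_le_den_le`, LevelFinite03 — same short name, resolved through K's own `open …LevelFinite`) and K's `partialSum_two_eq` (≡ `RootDecomp1KLevelFinite.lac_partialSum_two`, LevelFinite12 — the one use re-pointed by name); 36 one-line docstrings on undocumented computation lemmas of §6–§7 (statements quoted); otherwise none (K has no private / set_option / cite-token); provenance doc blocks + continuation headers = K's own open-lines; statements and proofs VERBATIM. Rung 0 — nothing here proves Schanuel, 33364, 33363, 31077 or ThinFibre 2; the class and members are HYPOTHESIS-FREE, §9 conditional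 on PadicSubspace / HeightComparison.)
-/

/-!
# RootDecomp1KIntegrality — lens 1, generation 55, node 15 «ODD-PLACE INTEGRALITY (Gauss on the level polynomial)»
  (RULE K-R45 payable clause «an infinite class of FRONTIER pairs made unconditional, any input»; CLAIM L2635,
   EX-ANTE PRICE + CHECKLIST K-g55 L2637; census LIVENESS-v5 L2636/L2638/L2639)

HONEST SCOPE (line 1).  ONE theorem-package on the K-line's thin-fibre residual `ThinFibreAt m₀ P` (tree
`RootDecomp1KDegreeLadder.ThinFibreAt`, DegreeLadder06) with NO binder, NO hypothesis `def … : Prop`, NO Literature fact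
assumed and NO Literature theorem used; the ONE new input is ELEMENTARY and GLOBAL: the rational-root theorem (Gauss's
lemma at the places `ℓ ∉ {2, ∞}`, Mathlib `den_dvd_of_is_root`) applied to the LEVEL POLYNOMIAL
`Q_N(Y) := Σ_{j ≤ k} p_N^j · 2^{(k−j)·N!} · c_j(Y) ∈ ℤ[Y]` of `P = Σ_j x^j c_j(Y)` at `x = s_N = p_N / 2^{N!}`.
WHAT IS NOT PROVED (line 2).  Rung count 0; NO ∀-item moves: 33364 / 33363 / 31077 / 31987 / `Schanuel` UNMOVED;
`ThinFibre 2` NOT proved; `PadicSubspace`, `HeightComparison`, `SiegelShapesOffAt 2`, `MachineOffAt 2`, `LocalOffAt 2`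
untouched; NOTHING is proved about `M17P`, `L17P` (node 11, `⟸ PadicSubspace`), `L13` / `R13` / `M13` (node 13, machine-decided)
or any `P` whose `Y`-leading coefficient is NOT a constant of `ℤ[x]` (`not_gaussAt_M17P`, `not_gaussAt_L13`, `not_gaussAt_mixed`).
The announced SEQUEL (the `J_0 = {0}` / bounded-NUMERATOR half with Literature `Ridout.finite_of_num_le`) is NOT built here
(see «SEQUEL» below) — by the PRICE it lands later as a ×0-AS-RECORD extension of this node.

PRIOR ART inside the cell (h3): the lever's `k = 1` case IS IN THE TREE — `RootDecomp1KXLinear.den_dvd_lc_two_pow` (XLinear02,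
node 2 Step 1a: for `x·B(Y) = A(Y)` with `deg A > deg B`, `den r ∣ lc(A) · 2^{v₂(den r)}`); node 15 is its every-`k` form, read
through node 14's engine (bounded `2`-adic region / far clause) with node 14's ROOT CONDITION DELETED.  Outside the cell:
presearch (HOME g55/presearch_g55.txt, corpus fts+vec AND galaxy, labelled) — problem-relative NULL; the rational-root theorem is
a textbook ingredient ([corpus:book:angell2022 p.50] etc.), nothing found joins it to rational points on `P(s_N, y) = 0`.

* §1 THE LEVER.  `levelPoly k c N := Σ_{j ≤ k} C (p_N^j · 2^{(k−j)·N!}) · c j ∈ ℤ[X]`; a level point `bev (xPolyP k c) s_N r = 0`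
  is a rational root of it (`aeval_levelPoly_eq_zero`, from the tree's `bev_xPolyP` / `partialSum_eq_psNumer_div`); under
  DOMINANCE `DomZero k c := ∀ j, 1 ≤ j → j ≤ k → deg (c j) < deg (c 0)` its leading coefficient is `2^{k·N!} · lc(c 0)`
  (`leadingCoeff_levelPoly` — `p_N` does NOT enter); Gauss (`rat_den_dvd_leadingCoeff`, Mathlib `den_dvd_of_is_root` moved from
  `IsFractionRing.den ℤ` to `Rat.den`) gives **`den_dvd_of_level : den r ∣ lc(c 0) · 2 ^ padicValNat 2 (den r)`** (typed over `ℤ`,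
  the `2`-power is `2 ^ padicValNat 2 r.den`: NO ℕ-subtraction, no `∃`), i.e. the ODD PART of `den r` divides the constant `lc(c₀)`;
  size form `den_le_of_level : ‖r‖₂ ≤ R → den r ≤ max 1 R · |lc(c 0)|` (tree `norm_ratCast_of_le`: `‖r‖₂ = 2^{v₂(den r)}` when `2 ∣ den r`).
* §2 `finite_rat_of_abs_le_den_le : {r : ℚ | |r| ≤ C ∧ den r ≤ D}.Finite` (image in `Icc × Icc` under `r ↦ (num, den)`) and
  `levels_finite_of_bounded`: the LEVELS carrying a NON-DEGENERATE point of bounded height are finitely many (finite union of the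
  tree's `levels_finite_of_nondeg`, XTop01 — the clause's proviso `∃ x, bev P x r ≠ 0` is exactly its hypothesis).
* §3 THE ENGINE `thinFibreAt_of_dom_farClause : DomZero k c → FarClause m₀ k c → ThinFibreAt m₀ (xPolyP k c)` — node 14's engine
  with the root condition on `c k` REPLACED BY NOTHING: the bounded region `‖r‖₂ ≤ R` carries finitely many rationals, hence is
  eventually free of non-degenerate points; beyond `R` the tree's far clause (`FarClause`, LocalExponent02) decides.  Edge `c 0 = 0`
  (then all `c j = 0`, every point degenerate) handled inside, not assumed away.  With the tree's slope supplier: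
  `thinFibreAt_of_dom_slopeCond : c k ≠ 0 → DomZero k c → SlopeCond m₀ k c → ThinFibreAt m₀ (xPolyP k c)` (`farClause_of_slopeCond`).
* §4 THE CLASS (intrinsic, tree `xdeg` / `xCoeff`, node 14's `SlopeCond` BY NAME):
  `GaussAt m₀ P := P ≠ 0 ∧ (∀ j, 1 ≤ j → j ≤ xdeg P → (xCoeff P j).natDegree < (xCoeff P 0).natDegree) ∧ SlopeCond m₀ (xdeg P) (xCoeff P)`;
  **THE THEOREM `thinFibreAt_of_gaussAt : GaussAt m₀ P → ThinFibreAt m₀ P` for EVERY `m₀ : ℕ`** (no `1 ≤ m₀` / `2 ≤ m₀` except what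
  `SlopeCond` itself forces on a given `P`; no `Prime`, no separability, any multiplicities, any `ℚ₂`-root structure of the top);
  presentation lemma `gaussAt_xPolyP_iff : c k ≠ 0 → (GaussAt m₀ (xPolyP k c) ↔ DomZero k c ∧ SlopeCond m₀ k c)`; `gaussAt_mono`;
  `natDegree_of_gaussAt : P.natDegree = (xCoeff P 0).natDegree`; the `xdeg P = 0` edge `gaussAt_of_xdeg_zero` (all points degenerate).
* §5 THE FRONTIER-CERTIFIED NAMED TARGET, HYPOTHESIS-FREE: **`thinFibreAt_H17P_all : 1 ≤ m₀ → ThinFibreAt m₀ H17P`** (node 12's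
  `thinFibreAt_two_H17P (hH : HeightComparison)` keeps its place in the tree as history; census LIVENESS-v4 row `H17P`: FRONTIER at
  `m₀ = 2, 3`; v5: «killed by odd-place integrality»): `gaussAt_H17P : 1 ≤ m₀ → GaussAt m₀ H17P` (`c₀ = Y⁵` monic, `5 > 1, 1, 4`;
  the only slope datum `5 − 4 = 1 < 3·m₀`), `not_gaussAt_zero_H17P`; `thinFibreAt_two_H17P'`, `_three_H17P'`, `_one_H17P`;
  `not_localAt_H17P : m₀ ≤ 4 → ¬ LocalAt m₀ H17P` (node 14's root condition refuses the irrational DOUBLE `ℚ₂`-root `√17` below `5`,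
  `not_rootCond_h17C_three`); `H17P_territory'` = `¬ DecidedAt 2 ∧ ¬ SepTopAt 2 ∧ ¬ LocalAt 2 ∧ thinThreshold = 5 ∧ ThinFibreAt 2`, no `hH`.
* §6 TWO NEW MEMBERS at `m₀ = 2` (census LIVENESS-v5 rows `RC2`, `GC2`: v4-FRONTIER types, GaussAt ⇒ killed):
  `RC2 := x²(Y − 1)² + x(Y³ − 2) + Y⁵` (RATIONAL DOUBLE centre `1`, Liouville-critical `m₀ = μ = 2`) and
  `GC2 := x²(Y² − 17) + x(Y³ + Y + 1) + (Y⁴ + Y³ − 2)` (`= M17P + Y⁴`; IRRATIONAL SIMPLE `ℚ₂`-centres `±√17`, Ridout-critical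
  `m₀ = 2μ = 2`): `thinFibreAt_two_RC2`, `thinFibreAt_two_GC2` hypothesis-free; position `not_localAt_two_RC2` (tree
  `not_rootCond_two_sq`), `not_localAt_two_GC2` (`not_rootCond_m17C_two`, the `M17P` pattern), `not_decidedAt_two_RC2 / _GC2`,
  `not_sepTopAt_RC2` (any `m₀`), `not_sepTopAt_two_GC2`, not two-term, not `x`-linear, not rootless-topped; honesty:
  `localAt_three_RC2`, `localAt_three_GC2`, `sepTopAt_three_GC2` (at `m₀ ≥ 3` both were already decided).
* §7 AN INFINITE FAMILY: `H17D D := x³(Y² − 17)² + x²Y + x(Y + 1) + Y^D` (`H17D_five : H17D 5 = H17P`):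
  `gaussAt_H17D : 5 ≤ D → D < 3·m₀ + 4 → GaussAt m₀ (H17D D)`, `thinFibreAt_two_H17D : 5 ≤ D → D ≤ 9 → ThinFibreAt 2 (H17D D)`,
  `thinFibreAt_H17D` (all `5 ≤ D < 3 m₀ + 4`); the slope bound is sharp for the class (`not_gaussAt_two_H17D_ten`: `D = 10` is a
  CRITICAL segment); `not_heightDecidedAt_two_H17D : 6 ≤ D → ¬ HeightDecidedAt 2 (H17D D)` (outside node 12's class even
  conditionally), `not_localAt_H17D : m₀ ≤ 4 → ¬ LocalAt m₀ (H17D D)`, `not_sepTopAt_H17D`.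
* §8 POSITION BY NAME: `gaussAt_two_contact` (the classes `LocalAt 2` and `GaussAt 2` OVERLAP — nothing new claimed for `contactC`),
  `not_gaussAt_two_highContact` (slope-critical; tree `not_slopeCond_two_highContact`) / `gaussAt_three_highContact`,
  `not_gaussAt_M17P` (`J_D = {0,1}`), `not_gaussAt_L13` (`J_D = {1}`), `not_gaussAt_mixed` (tie `J_D = {0,2}`).
* §9 BOOKKEEPING (×0, census convention «residual statement def»): `GaussOffAt m₀` := Siegel's clause off
  `DecidedAt ∨ MachineDecidedAt ∨ LocalAt ∨ GaussAt`; `gaussOffAt_of_localOffAt`; `thinFibre_of_gaussOffAt : 2 ≤ m₀ → GaussOffAt m₀ → ThinFibre m₀`.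

CORRECTION OF RECORD (checklist (8)).  The census/critic `2`-adic FRONTIER instrument (K-R44/K-R45, LIVENESS-v4) OVER-COUNTS:
a near branch (‖r‖₂ bounded) of a `P` with `J_D(P) := {j : deg c_j = deg_Y P} = {0}` is GLOBALLY FINITE (bounded denominators),
whatever its local exponent; K-R46 (ii) amends FRONTIER by «∧ NOT GLOBALLY-FINITE».  No clawback of nodes 11–13: their members
`M17P` / `L17P` / `L13` are NOT in `GaussAt` (by name above).

RESIDUAL CURRENCY after node 15 (checklist (10)).  OPEN TERRITORY at `m₀` := FRONTIER pairs (K-R45 as amended by K-R46 (ii)) with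
`|J_D| ≥ 2` or `J_D = {j₀ ≥ 1}`; UNCONDITIONAL PART := `DecidedAt ∨ MachineDecidedAt ∨ LocalAt ∨ GaussAt`; tabled conditional-only
members at `m₀ = 2` = `{M17P, L17P}` (`⟸ PadicSubspace`); print-currency residual (`SiegelShapesOffAt 2` / 33364) unchanged.

SEQUEL (NOT in this node; ×0-as-record when typed, PRICE L2637 anti-salami).  `J_0(P) := {j : c_j(0) ≠ 0} = {0}` gives
`num r ∣ 2^{k·N!} · c₀(0)`, i.e. BOUNDED NUMERATORS on `{‖r‖₂ ≥ ρ}`; with Literature `Ridout.finite_of_num_le` (RidoutIntegers, PROVED,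
reachable through the tree's XLinear01 import) node 14's branch (iii) exponent `2μ + 1` drops to `μ + 1` at irrational `ℚ₂`-centres —
it needs node 14's per-root engine re-plumbed (a K of comparable size), census v6 for the `J_0` column; not attempted here.

Namespace `Summit.Schanuel.Schanuel.Theorems.RootDecomp1KIntegrality`; imports the tree's port `…RootDecomp1KLocalExponent06` ONLY
(no Literature import); no `private`, no `instance`, no `set_option`, no notation, no `sorry`; axioms standard.
-/

noncomputable section

namespace Summit.Schanuel.Schanuel.Theorems.RootDecomp1KIntegrality

open Polynomial LiouvilleNumber
open scoped Nat
open Summit.Schanuel.Schanuel.Theorems.RootDecomp1KTwoBaseCell (psNumer partialSum_eq_psNumer_div coprime_psNumer)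
open Summit.Schanuel.Schanuel.Theorems.RootDecomp1KRelLiouvilleCell (partialSum_two_strictMono)
open Summit.Schanuel.Schanuel.Theorems.RootDecomp1KDegreeLadder
open Summit.Schanuel.Schanuel.Theorems.RootDecomp1KXLinear
open Summit.Schanuel.Schanuel.Theorems.RootDecomp1KXTop
open Summit.Schanuel.Schanuel.Theorems.RootDecomp1KXAll
open Summit.Schanuel.Schanuel.Theorems.RootDecomp1KLevelFinite
open Summit.Schanuel.Schanuel.Theorems.RootDecomp1KSubspaceBranch
open Summit.Schanuel.Schanuel.Theorems.RootDecomp1KHeightGrading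
open Summit.Schanuel.Schanuel.Theorems.RootDecomp1KHeightMachine
open Summit.Schanuel.Schanuel.Theorems.RootDecomp1KLocalExponent

/-! ## §1  The level polynomial over `ℤ` and GAUSS'S LEMMA AT THE ODD PLACES -/

/-- the level identity over `ℚ`, denominators cleared: `Σ_{j ≤ k} p_N^j · 2^{(k−j)·N!} · c_j(r) = 0`. -/
theorem level_identity_rat (k : ℕ) (c : ℕ → ℤ[X]) (N : ℕ) (r : ℚ)
    (hP : bev (xPolyP k c) (partialSum 2 N) r = 0) :
    ∑ j ∈ Finset.range (k + 1), (psNumer 2 N : ℚ) ^ j * 2 ^ ((k - j) * N !) * aeval r (c j) = 0 := by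
  set p : ℕ := psNumer 2 N with hpdef
  have hq0 : ∑ j ∈ Finset.range (k + 1), ((p : ℚ) / 2 ^ N !) ^ j * aeval r (c j) = 0 := by
    have hcast : ((∑ j ∈ Finset.range (k + 1), ((p : ℚ) / 2 ^ N !) ^ j * aeval r (c j) : ℚ) : ℝ) =
        bev (xPolyP k c) (partialSum 2 N) r := by
      rw [bev_xPolyP, lac_partialSum_two, Rat.cast_sum]
      refine Finset.sum_congr rfl fun j _ => ?_
      push_cast
      rw [aeval_ratCast, hpdef]
    have h := hcast.trans hP
    exact_mod_cast h
  have h := congrArg (fun w => (2 : ℚ) ^ (k * N !) * w) hq0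
  simp only [mul_zero, Finset.mul_sum] at h
  rw [← h]
  refine Finset.sum_congr rfl fun j hj => ?_
  have hjk : j ≤ k := by have := Finset.mem_range.mp hj; omega
  have h2 : (2 : ℚ) ^ (k * N !) = 2 ^ ((k - j) * N !) * 2 ^ (N ! * j) := by
    rw [← pow_add]; congr 1
    have : (k - j) * N ! + N ! * j = k * N ! := by
      rw [mul_comm (N !) j, ← add_mul, Nat.sub_add_cancel hjk]
    omega
  have h2j : (2 : ℚ) ^ (N ! * j) ≠ 0 := pow_ne_zero _ two_ne_zero
  rw [h2, div_pow, ← pow_mul]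
  field_simp

/-- **the level polynomial** `Q_N(Y) := Σ_{j ≤ k} p_N^j · 2^{(k−j)·N!} · c_j(Y) ∈ ℤ[Y]` — an INTEGER polynomial whose
rational roots are exactly the level points of `xPolyP k c` on `x = s_N`. -/
def levelPoly (k : ℕ) (c : ℕ → ℤ[X]) (N : ℕ) : ℤ[X] :=
  ∑ j ∈ Finset.range (k + 1), C ((psNumer 2 N : ℤ) ^ j * 2 ^ ((k - j) * N !)) * c j

/-- a level point is a rational root of the level polynomial. -/
theorem aeval_levelPoly_eq_zero (k : ℕ) (c : ℕ → ℤ[X]) {N : ℕ} {r : ℚ}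
    (hP : bev (xPolyP k c) (partialSum 2 N) r = 0) : aeval r (levelPoly k c N) = 0 := by
  have h := level_identity_rat k c N r hP
  unfold levelPoly
  rw [map_sum]
  rw [← h]
  refine Finset.sum_congr rfl fun j _ => ?_
  rw [map_mul, aeval_C, eq_intCast]
  push_cast
  ring

/-- **DOMINANCE of `c₀`** (the class datum): `deg c_j < deg c₀` for `1 ≤ j ≤ k` — the `Y`-leading coefficient of
`P = Σ x^j c_j(Y)` is the CONSTANT `lc(c₀) ∈ ℤ` (e.g. `P` monic in `Y`). -/
def DomZero (k : ℕ) (c : ℕ → ℤ[X]) : Prop :=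
  ∀ j, 1 ≤ j → j ≤ k → (c j).natDegree < (c 0).natDegree

/-- under dominance the level polynomial has leading coefficient `2^{k·N!} · lc(c₀)` — `p_N` does NOT enter. -/
theorem leadingCoeff_levelPoly (k : ℕ) (c : ℕ → ℤ[X]) (hdom : DomZero k c) (h0 : c 0 ≠ 0) (N : ℕ) :
    (levelPoly k c N).leadingCoeff = 2 ^ (k * N !) * (c 0).leadingCoeff := by
  unfold levelPoly
  rw [Finset.sum_range_succ']
  simp only [pow_zero, one_mul, Nat.sub_zero]
  have hdeg0 : (C ((2 : ℤ) ^ (k * N !)) * c 0).degree = (c 0).degree :=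
    degree_C_mul (pow_ne_zero _ two_ne_zero)
  have hlt : (∑ j ∈ Finset.range k, C ((psNumer 2 N : ℤ) ^ (j + 1) * 2 ^ ((k - (j + 1)) * N !)) * c (j + 1)).degree <
      (C ((2 : ℤ) ^ (k * N !)) * c 0).degree := by
    rw [hdeg0]
    refine lt_of_le_of_lt (degree_sum_le _ _) ?_
    rw [Finset.sup_lt_iff (bot_lt_iff_ne_bot.mpr (degree_ne_bot.mpr h0))]
    intro j hj
    have hjk : j + 1 ≤ k := by have := Finset.mem_range.mp hj; omega
    refine lt_of_le_of_lt (degree_mul_le _ _) ?_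
    refine lt_of_le_of_lt (add_le_add degree_C_le le_rfl) ?_
    rw [zero_add, degree_eq_natDegree h0]
    by_cases hcj : c (j + 1) = 0
    · rw [hcj, degree_zero]; exact WithBot.bot_lt_coe _
    · rw [degree_eq_natDegree hcj]
      exact_mod_cast hdom (j + 1) (by omega) hjk
  rw [leadingCoeff_add_of_degree_lt hlt, leadingCoeff_mul, leadingCoeff_C]

/-- Gauss: the reduced denominator of a rational root of an integer polynomial divides its leading coefficient
(Mathlib `den_dvd_of_is_root`, transported from `IsFractionRing.den ℤ` to `Rat.den`). -/
theorem rat_den_dvd_leadingCoeff (Q : ℤ[X]) (r : ℚ) (hr : aeval r Q = 0) : (r.den : ℤ) ∣ Q.leadingCoeff := by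
  have h1 := den_dvd_of_is_root (A := ℤ) (K := ℚ) hr
  have h2 : (algebraMap ℤ ℚ (IsFractionRing.num ℤ r)) / (algebraMap ℤ ℚ (IsFractionRing.den ℤ r : ℤ)) = r := by
    rw [← IsFractionRing.mk'_eq_div]; exact IsFractionRing.mk'_num_den ℤ r
  have h3 : (r.den : ℤ) ∣ (IsFractionRing.den ℤ r : ℤ) := by
    have e : r = Rat.divInt (IsFractionRing.num ℤ r) (IsFractionRing.den ℤ r : ℤ) := by
      rw [Rat.divInt_eq_div]; simpa using h2.symm
    conv_lhs => rw [e]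
    exact Rat.den_dvd _ _
  exact h3.trans h1

/-- **GAUSS AT THE ODD PLACES** (the node's one new input, for every `x`-degree `k`): under dominance of `c₀`, every
level point `r` of `xPolyP k c` has `den r ∣ lc(c₀) · 2^{v₂(den r)}` — the ODD PART of `den r` divides the constant
`lc(c₀)`; equivalently `r` is integral at every prime `ℓ ∉ {2} ∪ {ℓ ∣ lc(c₀)}`.  (Tree, `k = 1` only:
`RootDecomp1KXLinear.den_dvd_lc_two_pow`.) -/
theorem den_dvd_of_level (k : ℕ) (c : ℕ → ℤ[X]) (hdom : DomZero k c) (h0 : c 0 ≠ 0) {N : ℕ} {r : ℚ}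
    (hP : bev (xPolyP k c) (partialSum 2 N) r = 0) :
    (r.den : ℤ) ∣ (c 0).leadingCoeff * 2 ^ padicValNat 2 r.den := by
  have h1 : (r.den : ℤ) ∣ 2 ^ (k * N !) * (c 0).leadingCoeff :=
    leadingCoeff_levelPoly k c hdom h0 N ▸ rat_den_dvd_leadingCoeff _ r (aeval_levelPoly_eq_zero k c hP)
  set t := padicValNat 2 r.den with ht
  obtain ⟨q', hq'⟩ : 2 ^ t ∣ r.den := pow_padicValNat_dvd
  have hq'odd : ¬ 2 ∣ q' := by
    intro h2
    have : 2 ^ (t + 1) ∣ r.den := by rw [hq', pow_succ]; exact Nat.mul_dvd_mul_left _ h2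
    exact absurd this (pow_succ_padicValNat_not_dvd r.den_nz)
  have hqd : (q' : ℤ) ∣ (r.den : ℤ) := ⟨2 ^ t, by rw [hq']; push_cast; ring⟩
  have h2 : (q' : ℤ) ∣ 2 ^ (k * N !) * (c 0).leadingCoeff := hqd.trans h1
  have hcop : IsCoprime (q' : ℤ) ((2 : ℤ) ^ (k * N !)) := by
    apply IsCoprime.pow_right
    rw [Int.isCoprime_iff_gcd_eq_one, show ((q' : ℤ)).gcd 2 = Nat.gcd q' 2 from Int.gcd_natCast_natCast q' 2]
    exact ((Nat.Prime.coprime_iff_not_dvd Nat.prime_two).mpr hq'odd).symm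
  have h3 : (q' : ℤ) ∣ (c 0).leadingCoeff := hcop.dvd_of_dvd_mul_left h2
  rw [hq']
  push_cast
  rw [mul_comm ((c 0).leadingCoeff)]
  exact mul_dvd_mul_left _ h3

/-- the size form: a level point with `‖r‖₂ ≤ R` has `den r ≤ max 1 R · |lc(c₀)|` — BOUNDED. -/
theorem den_le_of_level (k : ℕ) (c : ℕ → ℤ[X]) (hdom : DomZero k c) (h0 : c 0 ≠ 0) {N : ℕ} {r : ℚ}
    (hP : bev (xPolyP k c) (partialSum 2 N) r = 0) {R : ℝ} (hrR : ‖(r : PadicAlgCl 2)‖ ≤ R) :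
    (r.den : ℝ) ≤ max 1 R * |((c 0).leadingCoeff : ℝ)| := by
  have hlc : (c 0).leadingCoeff ≠ 0 := leadingCoeff_ne_zero.mpr h0
  have hdvd := den_dvd_of_level k c hdom h0 hP
  -- `den r ≤ |lc| · 2^t` as naturals/integers
  have hle : (r.den : ℤ) ≤ |(c 0).leadingCoeff * 2 ^ padicValNat 2 r.den| :=
    Int.le_of_dvd (abs_pos.mpr (mul_ne_zero hlc (pow_ne_zero _ two_ne_zero))) ((dvd_abs _ _).mpr hdvd)
  rw [abs_mul, abs_of_nonneg (by positivity : (0 : ℤ) ≤ 2 ^ padicValNat 2 r.den)] at hle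
  have hle' : (r.den : ℝ) ≤ |((c 0).leadingCoeff : ℝ)| * (2 : ℝ) ^ padicValNat 2 r.den := by
    have := (Int.cast_le (R := ℝ)).mpr hle
    push_cast at this
    exact this
  -- `2^t ≤ max 1 R`
  have h2t : (2 : ℝ) ^ padicValNat 2 r.den ≤ max 1 R := by
    rcases Nat.eq_zero_or_pos (padicValNat 2 r.den) with ht0 | htpos
    · rw [ht0, pow_zero]; exact le_max_left _ _
    · rw [← norm_ratCast_of_le htpos]; exact hrR.trans (le_max_right _ _)
  calc (r.den : ℝ) ≤ |((c 0).leadingCoeff : ℝ)| * (2 : ℝ) ^ padicValNat 2 r.den := hle'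
    _ ≤ |((c 0).leadingCoeff : ℝ)| * max 1 R := mul_le_mul_of_nonneg_left h2t (abs_nonneg _)
    _ = max 1 R * |((c 0).leadingCoeff : ℝ)| := mul_comm _ _

/-! ## §2  Bounded height: finitely many rationals, finitely many levels -/

/-- the LEVELS carrying a non-degenerate point of bounded height are finitely many (tree `levels_finite_of_nondeg`,
per point). -/
theorem levels_finite_of_bounded (P : ℤ[X][X]) (C D : ℝ) :
    (⋃ r ∈ {r : ℚ | |(r : ℝ)| ≤ C ∧ (r.den : ℝ) ≤ D},
      {N : ℕ | bev P (partialSum 2 N) r = 0 ∧ ∃ x : ℝ, bev P x r ≠ 0}).Finite := by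
  refine (finite_rat_of_abs_le_den_le C D).biUnion fun r _ => ?_
  by_cases hnd : ∃ x : ℝ, bev P x r ≠ 0
  · exact (levels_finite_of_nondeg _ r hnd).subset fun N hN => hN.1
  · exact Set.finite_empty.subset fun N hN => (hnd hN.2).elim

end Summit.Schanuel.Schanuel.Theorems.RootDecomp1KIntegrality

end
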